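import Literature.ModelTheory.ExponentialFields.DefinitionalExpansion
import Literature.ModelTheory.ExponentialFields.PilaWilkieCountingProofs
import Literature.ModelTheory.ExponentialFields.Languages
import HarnessLib

/-!
# From "the graphs of `+` and `·` are definable" to an expansion of the ordered ring language (a definitional-expansion bridge)

Topic `Literature/ModelTheory/ExponentialFields`; infrastructure in the cone of the named fact
`PilaWilkie2006_thm_1_8`.  Two conventions for "an o-minimal expansion of the real field"
coexist in the tree: (i) a language `L` on `ℝ` with the graphs of `+`, `·` definable with
parameters (the hypothesis shape of `PilaWilkie2006_thm_1_8`), and (ii) a language map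
`φ : Language.orderedRing →ᴸ L` which is an expansion on `ℝ` (the shape of the tree's `C¹`
theory: generic smoothness, definable choice, …).  Here (i) ⇒ (ii): the definitional expansion
`L' := L[[ℝ]] ⊕ orderedRing` of `L` with names for all reals (Hodges 1993, §2.6, via the
tree's `Definitions.IsDefinedBy`) has **the same sets definable with parameters** as `L`, is
o-minimal when `L` is, and `LHom.sumInr : orderedRing →ᴸ L'` is an expansion on `ℝ`
(`exists_orderedRing_expansion`).  Helpers: `exists_formula_of_definable`,
`definable_of_definable_withConstants` (collapsing doubled parameters along the language map
summing the two constant copies), `exists_definitions_orderedRing`.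

Nothing here is a named fact; no definitions (the expansion is produced existentially).

## References

* W. Hodges, *Model Theory*, CUP 1993, §2.6 (definitional expansions, Thm. 2.6.4).
  [Hodges1993]
-/

noncomputable section

open Set FirstOrder FirstOrder.Language

namespace Literature.ModelTheory.ExponentialFields

/-! ### From "graphs of `+`, `·` definable" to an expansion of `Language.orderedRing` with the same definable sets -/

section Bridge

open Classical

variable {L : FirstOrder.Language.{0, 0}} [L.Structure ℝ]

/-- Parameter-free defining formulas from definability with parameters: a set definable in `L`
with real parameters is defined by a formula of `L[[ℝ]]` (`L` with a name for every real).
[folklore] -/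
theorem exists_formula_of_definable {α : Type} {s : Set (α → ℝ)}
    (hs : (univ : Set ℝ).Definable L s) :
    ∃ φ : (L[[(univ : Set ℝ)]]).Formula α, s = setOf φ.Realize :=
  empty_definable_iff.mp (definable_iff_empty_definable_with_params.mp hs)

/-- **Collapsing doubled parameters**: a set definable with real parameters in `L[[ℝ]]` is
definable with real parameters in `L`. [folklore] -/
theorem definable_of_definable_withConstants {α : Type} {s : Set (α → ℝ)}
    (hs : (univ : Set ℝ).Definable (L[[(univ : Set ℝ)]]) s) : (univ : Set ℝ).Definable L s := by
  obtain ⟨θ, rfl⟩ := empty_definable_iff.mp (definable_iff_empty_definable_with_params.mp hs)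
  -- the language map summing the two copies of the constants
  let ψ : (L[[(univ : Set ℝ)]])[[(univ : Set ℝ)]] →ᴸ L[[(univ : Set ℝ)]] :=
    LHom.sumElim (LHom.id _) LHom.sumInr
  have hψ : ψ.IsExpansionOn ℝ := by
    refine ⟨fun f x => ?_, fun R x => ?_⟩
    · rcases f with f | c
      · rfl
      · rfl
    · rcases R with R | R
      · rfl
      · rfl
  rw [definable_iff_empty_definable_with_params, empty_definable_iff]
  refine ⟨ψ.onFormula θ, ?_⟩
  ext v
  simp only [mem_setOf_eq]
  haveI := hψ
  exact (LHom.realize_onFormula ψ θ).symm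

/-- The definitions of the ordered-ring symbols by `L[[ℝ]]`-formulas, given that the graphs of `+`
and `·` are `L`-definable with parameters. [folklore] -/
theorem exists_definitions_orderedRing
    (hadd : (univ : Set ℝ).Definable L {v : Fin 3 → ℝ | v 0 + v 1 = v 2})
    (hmul : (univ : Set ℝ).Definable L {v : Fin 3 → ℝ | v 0 * v 1 = v 2}) :
    ∃ D : Definitions (L[[(univ : Set ℝ)]]) Language.orderedRing, D.IsDefinedBy ℝ := by
  -- graphs in the `Fin.cons y x` convention
  have hG : ∀ {k : ℕ} (g : Language.orderedRing.Functions k),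
      ∃ φ : (L[[(univ : Set ℝ)]]).Formula (Fin (k + 1)),
        ∀ (x : Fin k → ℝ) (y : ℝ), φ.Realize (Fin.cons y x) ↔ Structure.funMap g x = y := by
    intro k g
    -- the graph set `{w : Fin (k+1) → ℝ | funMap g (tail w) = w 0}` is `L`-definable
    have hset : (univ : Set ℝ).Definable L {w : Fin (k + 1) → ℝ | Structure.funMap g (Fin.tail w) = w 0} := by
      cases g with
      | add =>
        have h := definable_setOf_eq' (L := L)
          (definableFun_add hadd (definableFun_proj (1 : Fin 3)) (definableFun_proj (2 : Fin 3)))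
          (definableFun_proj (0 : Fin 3))
        convert h using 1
        ext w; simp [Fin.tail]
      | mul =>
        have h := definable_setOf_eq' (L := L)
          (definableFun_mul hmul (definableFun_proj (1 : Fin 3)) (definableFun_proj (2 : Fin 3)))
          (definableFun_proj (0 : Fin 3))
        convert h using 1
        ext w; simp [Fin.tail]
      | neg =>
        have h := definable_setOf_eq' (L := L)
          (definableFun_neg hadd (definableFun_proj (1 : Fin 2))) (definableFun_proj (0 : Fin 2))
        convert h using 1
        ext w; simp [Fin.tail]
      | zero =>
        have h := definable_setOf_eq' (L := L) (definableFun_const' (Fin 1) (0 : ℝ)) (definableFun_proj (0 : Fin 1))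
        convert h using 1
        ext w; simp
      | one =>
        have h := definable_setOf_eq' (L := L) (definableFun_const' (Fin 1) (1 : ℝ)) (definableFun_proj (0 : Fin 1))
        convert h using 1
        ext w; simp
    obtain ⟨φ, hφ⟩ := exists_formula_of_definable hset
    refine ⟨φ, fun x y => ?_⟩
    have h := Set.ext_iff.mp hφ (Fin.cons y x)
    simp only [mem_setOf_eq, Fin.tail_cons, Fin.cons_zero] at h
    exact h.symm
  have hR : ∀ {k : ℕ} (R : Language.orderedRing.Relations k),
      ∃ φ : (L[[(univ : Set ℝ)]]).Formula (Fin k), ∀ (x : Fin k → ℝ), φ.Realize x ↔ Structure.RelMap R x := by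
    intro k R
    cases R with
    | le =>
      have hset : (univ : Set ℝ).Definable L {w : Fin 2 → ℝ | w 0 ≤ w 1} :=
        definable_setOf_le (definable_lt_of_field hadd hmul) (definableFun_proj _) (definableFun_proj _)
      obtain ⟨φ, hφ⟩ := exists_formula_of_definable hset
      refine ⟨φ, fun x => ?_⟩
      have h := Set.ext_iff.mp hφ x
      simp only [mem_setOf_eq] at h
      exact h.symm
  choose δ hδ using fun k (g : Language.orderedRing.Functions k) => hG g
  choose ρ hρ using fun k (R : Language.orderedRing.Relations k) => hR R
  exact ⟨⟨fun g => δ _ g, fun R => ρ _ R⟩, ⟨fun g x y => hδ _ g x y, fun R x => hρ _ R x⟩⟩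

/-- **The bridge to expansions of the ordered ring language.**  For a first-order structure `L`
on `ℝ` in which the graphs of `+` and `·` are definable (the hypothesis shape of
`PilaWilkie2006_thm_1_8`) there is a language `L'` on `ℝ` expanding `Language.orderedRing`
(the definitional expansion of `L[[ℝ]]` by `+, ·, −, 0, 1, ≤`) with exactly the same sets
definable with parameters, hence o-minimal when `L` is; through it every theorem of the tree
stated for `φ : Language.orderedRing →ᴸ L'`, `[φ.IsExpansionOn ℝ]` becomes available.
[cite: Hodges1993, Thm 2.6.4] -/
theorem exists_orderedRing_expansion
    (hadd : (univ : Set ℝ).Definable L {v : Fin 3 → ℝ | v 0 + v 1 = v 2})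
    (hmul : (univ : Set ℝ).Definable L {v : Fin 3 → ℝ | v 0 * v 1 = v 2}) :
    ∃ (L' : FirstOrder.Language.{0, 0}) (_ : L'.Structure ℝ) (φ : Language.orderedRing →ᴸ L') (_ : φ.IsExpansionOn ℝ),
      (∀ {α : Type} (s : Set (α → ℝ)), (univ : Set ℝ).Definable L' s ↔ (univ : Set ℝ).Definable L s) ∧
      (L.IsOMinimal ℝ → L'.IsOMinimal ℝ) := by
  obtain ⟨D, hD⟩ := exists_definitions_orderedRing hadd hmul
  refine ⟨(L[[(univ : Set ℝ)]]).sum Language.orderedRing, inferInstance, LHom.sumInr, inferInstance, ?_, ?_⟩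
  · intro α s
    constructor
    · intro hs
      exact definable_of_definable_withConstants (hD.definable_of_definable_sum hs)
    · intro hs
      have h1 : (univ : Set ℝ).Definable (L[[(univ : Set ℝ)]]) s :=
        hs.map_expansion (L.lhomWithConstants (univ : Set ℝ))
      exact Definitions.IsDefinedBy.definable_sum_of_definable h1
  · intro hO s hs
    refine hO s ?_
    unfold Set.Definable₁ at hs ⊢
    exact definable_of_definable_withConstants (hD.definable_of_definable_sum hs)

end Bridge


end Literature.ModelTheory.ExponentialFields

end
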